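import Summits.QuantumFields.BalabanUV.Beta.GAN24.CoDressedColumnPairing
import Summits.QuantumFields.BalabanUV.Beta.AxialDressingRootedSupport
import Summits.QuantumFields.BalabanUV.Beta.D1BFx.GhostWardWord
import Summits.QuantumFields.BalabanUV.Beta.D1BFx.RestJetEnvelopes

/-!
# `BalabanUV.Beta.D1BFx.BlockGaugeEnvelope` — road «BF-x» for binder row D1, slot (K), junction (J3), ROUTE M of TB5-1′ ((C3) by the Ward route),
# FILE A: **THE DECAYING ENVELOPE OF THE BLOCK GAUGE FUNCTION** `χ_{μ,y} := bmGaugeAt (toSite r) (colH K₀ n μ y) n` of the road's co-dressing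
# (`colH G₀ = colH K₀ − grad χ`, gan24-leaf-05's `CoDressedColumnPairing.colH_coDressKBmAt_eq_sub_grad`):
# `|χ_{μ,y}(x)| ≤ 8·(M·P·e^{κ₁})·e^{2κ₁} · n⁻⁴ · e^{−(κ₁∕(4n))·|x − n•y|₁}` (`κ₁ = kappa163 4 ∕ 4`)

WHY (journal [D1LEAF04-G22-ONLINE] ∕ [D1LEAF04-G22-INTENT-B]): FILE B's frozen-averaging Ward identities take a LOCALISED gauge function
(`hf : ∀ x, |f x| ≤ Cf·e^{−δ|x − p|₁}`, `δ > 0`); the gauge function of the road's dressed weights is the block-mean-normalised rooted tree integral of the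
undressed column `colH K₀ n μ y`, whose letters are `±colH K₀ n μ y κ w` at bonds `w` INSIDE THE BLOCK of `x` (an2's `AxialDressingRootedSupport.mem_axial_hull`),
at most `4n` of them (`AxialDressingRooted.axial_length_le_of_root`); the column's own envelope (`RestJetEnvelopes.abs_wH_fine_le`: `n⁻⁵·M·P·e^{κ₁}·e^{−(κ₁∕4n)|w − n•y|₁}`)
moves from `w` to `x` at the price `e^{κ₁}` (`|w − x|₁ ≤ 4n`), and the block mean costs one more `e^{κ₁}`.  The previous uniform letter
(`TwoBondWardPairingRoad.abs_bmGaugeAt_colH_K₀_le`: `≤ 2·4·n·M·P`, no decay, no `n⁻⁵`) is not enough for (C3): the χ-words of FILE C must be LOCALISED at `n•y`.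

CONTENT (all [folklore]; `d = 3`, i.e. `ℤ⁴`): §1 generic — `l1_sub_le_of_window` (a point of the half-open block window of `x` is `4N`-close to `x`),
`l1_hull_root_le` (letter sites of the rooted axial contour), **`abs_treeGaugeAt_le_env`**, `abs_blockMeanAt_le_window`, **`abs_bmGaugeAt_le_env`**
(`|A κ w| ≤ C·e^{−δ|w − q|₁}`, `δ ≥ 0` ⟹ `|bmGaugeAt (toSite r) A N x| ≤ 8·N·C·e^{8Nδ}·e^{−δ|x − q|₁}`); §2 the instance — `abs_colH_K₀_env`,
**`abs_bmGauge_colH_K₀_le`** (the displayed envelope), `bmGauge_colH_K₀_env_pos`.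
NOT HERE: the Ward algebra (FILE B), the gauge-variation identity (FILE C), masses and rows (FILE D).

HONEST DEPENDENCY (cell records, verbatim): «continuum YM on T⁴ ⇐ BetaPertH ∧ nine spine estimates (0/9 proved); BetaPertH ⇐ (D1) ∧ (D4) ∧
CAP+tail; G-an2-4 gates asym, D1 and NE2/3/4.»  HONEST FRAMING (cell contract, verbatim): «discharging `BetaPertH` makes Bałaban's UV stability
UNCONDITIONAL — a real constructive-QFT result; it is NOT the continuum limit and NOT the Clay problem.»  THIS MODULE DISCHARGES NOTHING of (K),
of D1 or of the wall: a [folklore] bookkeeping bound on OUR block gauge function.  No definition, no `def … : Prop`, nothing cited, 0 sorry.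
0 root-level binders of row D1 discharged; (J3) DISPLAYED; (K) NOT closed; NOT D1, NOT `BetaPertH`, NOT continuum, NOT Clay.
ABSOLUTE RULE (cell charter, verbatim): «No internally-minted statement may enter as a cited fact. Every hypothesis is either kernel-proved in this
package or a verbatim quotation of a PUBLISHED theorem with page reference. The manuscript(s) under audit are NOT citable for their own disputed
steps — they are the thing under adjudication; programme-internal (2001/route/tribunal) claims are never citable.»
Unit `b2b-balaban-beta-d1-formalise-leaf-04` (gen 22), D1 formalisation swarm leaf prover 04, road «BF-x»; ROUTE M (C3), FILE A (journal [D1LEAF04-G22-*]).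
-/

noncomputable section

namespace Summit.QuantumFields.BalabanUV.Beta.D1BFx.BlockGaugeEnvelope

open Finset
open scoped BigOperators
open Literature.MathematicalPhysics.QuantumFieldTheory.Balaban1983to89
open Literature.MathematicalPhysics.QuantumFieldTheory.Balaban1983to89.Beta
open B12Sec2to5 (l1 l1_nonneg)
open B5Hk163Strip (kappa163 kappa163_pos)
open B5Hk163Decay (MG163)
open B4TorusKernel (periodConst)
open ExpKernelCalculus (Site l1_sub_triangle l1_sub_symm)
open AffineAveraging (Form0 Form1 box toSite blockSum unitVec)
open AveragingContours (axial blk)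
open AveragingContoursRooted (treeGaugeAt)
open AxialProjector (zsmul_blk_le lt_zsmul_blk_add)
open KernelSpecInstance (wH)
open OneStepKernelFamily (KInvStep colH)
open Summit.QuantumFields.BalabanUV.Beta.AxialProjectorBlockMean (blockMeanAt bmGaugeAt)
open Summit.QuantumFields.BalabanUV.Beta.AxialDressingRooted (axial_length_le_of_root InHull mem_axial_hull)
open Summit.QuantumFields.BalabanUV.Beta.GAN24.CoDressedColumnPairing (abs_list_sum_le_of_forall_abs_le)
open Summit.QuantumFields.BalabanUV.Beta.D1BFx.GhostWardWord (colH_K₀_eq_wH)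
open Summit.QuantumFields.BalabanUV.Beta.D1BFx.RestJetEnvelopes (abs_wH_fine_le)

/-! ## §1 Generic: a form with an exponential envelope has a rooted block gauge function with the same envelope -/

section Generic

variable {N : ℕ} (hN : 1 ≤ N) {r : Fin 4 → ℕ} (hr : r ∈ box 4 N)
include hN

/-- [folklore] **THE BLOCK WINDOW IS `4N`-SMALL**: if every coordinate of `w` lies in the half-open window `[N·blk x, N·blk x + N)` of the block of `x`,
then `|w − x|₁ ≤ 4N`. -/
theorem l1_sub_le_of_window (x w : Site 4) (hw : ∀ j, ((N : ℤ) • blk N x) j ≤ w j ∧ w j < ((N : ℤ) • blk N x) j + N) :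
    l1 (w - x) ≤ 4 * (N : ℝ) := by
  have hj : ∀ j : Fin 4, |(((w - x) j : ℤ) : ℝ)| ≤ N := by
    intro j
    have h1 := zsmul_blk_le hN x j
    have h2 := lt_zsmul_blk_add hN x j
    obtain ⟨h3, h4⟩ := hw j
    have key : |(w - x) j| ≤ (N : ℤ) := by rw [Pi.sub_apply, abs_le]; constructor <;> linarith
    exact_mod_cast key
  unfold l1
  calc ∑ j, |(((w - x) j : ℤ) : ℝ)| ≤ ∑ _j : Fin 4, (N : ℝ) := Finset.sum_le_sum fun j _ => hj j
    _ = 4 * (N : ℝ) := by simp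

include hr

/-- [folklore] **LETTER SITES OF THE ROOTED AXIAL CONTOUR ARE IN THE BLOCK WINDOW**: a hull point of the in-block root `N·blk x + r` and `x`
is `4N`-close to `x`. -/
theorem l1_hull_root_le (x : Site 4) {z : Site 4} (hz : InHull ((N : ℤ) • blk N x + toSite r) x z) : l1 (z - x) ≤ 4 * (N : ℝ) := by
  refine l1_sub_le_of_window hN x z fun j => ?_
  have h1 := zsmul_blk_le hN x j
  have h2 := lt_zsmul_blk_add hN x j
  have hrj : (r j : ℤ) < N := by exact_mod_cast Finset.mem_range.1 (Fintype.mem_piFinset.1 hr j)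
  have hr0 : (0 : ℤ) ≤ (r j : ℤ) := by positivity
  have e : (((N : ℤ) • blk N x + toSite r) j : ℤ) = ((N : ℤ) • blk N x) j + (r j : ℤ) := by simp [toSite]
  have hb := hz.bounds (j := j) (L := ((N : ℤ) • blk N x) j) (U := ((N : ℤ) • blk N x) j + N - 1)
    (by rw [e]; linarith) (by rw [e]; linarith) h1 (by linarith)
  exact ⟨hb.1, by linarith [hb.2]⟩

variable {A : Form1 4 ℝ} {C δ : ℝ} {q : Site 4} (hδ : 0 ≤ δ) (hC : 0 ≤ C) (hA : ∀ κ w, |A κ w| ≤ C * Real.exp (-δ * l1 (w - q)))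
include hδ hC hA

omit hN hr in
/-- [folklore] The envelope moves from a `4N`-close site `w` to `x` at the price `e^{4Nδ}`. -/
theorem env_shift {w x : Site 4} (hwx : l1 (w - x) ≤ 4 * (N : ℝ)) (κ : Fin 4) :
    |A κ w| ≤ C * Real.exp (4 * (N : ℝ) * δ) * Real.exp (-δ * l1 (x - q)) := by
  refine (hA κ w).trans ?_
  rw [mul_assoc, ← Real.exp_add]
  refine mul_le_mul_of_nonneg_left (Real.exp_le_exp.2 ?_) hC
  have t : l1 (x - q) ≤ l1 (x - w) + l1 (w - q) := l1_sub_triangle x w q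
  rw [l1_sub_symm x w] at t
  nlinarith

/-- [folklore] **THE ROOTED TREE INTEGRAL INHERITS THE ENVELOPE**: `|treeGaugeAt (toSite r) A N x| ≤ 4N·C·e^{4Nδ}·e^{−δ|x − q|₁}` (at most `4N` letters,
each a value `±A κ w` with `w` in the block window of `x`). -/
theorem abs_treeGaugeAt_le_env (x : Site 4) :
    |treeGaugeAt (toSite r) A N x| ≤ 4 * (N : ℝ) * (C * Real.exp (4 * (N : ℝ) * δ) * Real.exp (-δ * l1 (x - q))) := by
  unfold treeGaugeAt
  have h1 : ∀ a ∈ axial A ((N : ℤ) • blk N x + toSite r) x, |a| ≤ C * Real.exp (4 * (N : ℝ) * δ) * Real.exp (-δ * l1 (x - q)) := by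
    intro a ha
    obtain ⟨κ, z', hor, hz', -⟩ := mem_axial_hull ha
    have hb := env_shift hδ hC hA (l1_hull_root_le hN hr x hz') κ
    rcases hor with e | e
    · rw [e]; exact hb
    · rw [e, abs_neg]; exact hb
  have h2 := abs_list_sum_le_of_forall_abs_le h1
  have h3 : ((axial A ((N : ℤ) • blk N x + toSite r) x).length : ℝ) ≤ 4 * (N : ℝ) := by
    have := axial_length_le_of_root hN hr A x
    exact_mod_cast this
  exact h2.trans (mul_le_mul_of_nonneg_right h3 (by positivity))

omit hr hδ hC hA in
/-- [folklore] **A BLOCK MEAN IS DOMINATED BY THE WINDOW SUPREMUM**: if `|f w| ≤ B` on the block window of `x`, then `|blockMeanAt N f x| ≤ B`. -/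
theorem abs_blockMeanAt_le_window {f : Form0 4 ℝ} {B : ℝ} (x : Site 4)
    (hf : ∀ w : Site 4, (∀ j, ((N : ℤ) • blk N x) j ≤ w j ∧ w j < ((N : ℤ) • blk N x) j + N) → |f w| ≤ B) :
    |blockMeanAt N f x| ≤ B := by
  have hcard : ((box 4 N).card : ℝ) = (N : ℝ) ^ 4 := by
    simp only [AffineAveraging.box, Fintype.card_piFinset, Finset.card_range, Finset.prod_const, Finset.card_univ, Fintype.card_fin]
    push_cast; ring
  have hNpos : (0 : ℝ) < (N : ℝ) ^ 4 := by
    have hN0 : (0:ℝ) < N := by exact_mod_cast hN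
    positivity
  have hwin : ∀ b ∈ box 4 N, |f ((N : ℤ) • blk N x + toSite b)| ≤ B := by
    intro b hb
    refine hf _ fun j => ?_
    have hbj : (b j : ℤ) < N := by exact_mod_cast Finset.mem_range.1 (Fintype.mem_piFinset.1 hb j)
    have hb0 : (0 : ℤ) ≤ (b j : ℤ) := by positivity
    simp only [Pi.add_apply, toSite]
    constructor <;> linarith
  have hB : 0 ≤ B := by
    have h0 : (fun _ : Fin 4 => (0 : ℕ)) ∈ box 4 N := Fintype.mem_piFinset.2 fun _ => Finset.mem_range.2 (by omega)
    exact (abs_nonneg _).trans (hwin _ h0)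
  simp only [blockMeanAt, blockSum]
  rw [abs_div, abs_of_pos hNpos, div_le_iff₀ hNpos]
  calc |∑ b ∈ box 4 N, f ((N : ℤ) • blk N x + toSite b)| ≤ ∑ b ∈ box 4 N, |f ((N : ℤ) • blk N x + toSite b)| := Finset.abs_sum_le_sum_abs _ _
    _ ≤ ∑ _b ∈ box 4 N, B := Finset.sum_le_sum hwin
    _ = B * (N : ℝ) ^ 4 := by rw [Finset.sum_const, nsmul_eq_mul, hcard, mul_comm]

/-- [folklore] **THE BLOCK-MEAN-NORMALISED TREE GAUGE INHERITS THE ENVELOPE**: `|bmGaugeAt (toSite r) A N x| ≤ 8N·C·e^{8Nδ}·e^{−δ|x − q|₁}`. -/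
theorem abs_bmGaugeAt_le_env (x : Site 4) :
    |bmGaugeAt (toSite r) A N x| ≤ 8 * (N : ℝ) * C * Real.exp (8 * (N : ℝ) * δ) * Real.exp (-δ * l1 (x - q)) := by
  have hNr : (1 : ℝ) ≤ N := by exact_mod_cast hN
  -- the tree integral at `x`
  have h1 := abs_treeGaugeAt_le_env hN hr hδ hC hA x
  -- the block mean: every window point `w` is `4N`-close to `x`, so its tree integral is `≤ 4N·C·e^{4Nδ}·e^{4Nδ}·e^{−δ|x−q|}`
  have h2 : |blockMeanAt N (treeGaugeAt (toSite r) A N) x| ≤ 4 * (N : ℝ) * (C * Real.exp (4 * (N : ℝ) * δ) * (Real.exp (4 * (N : ℝ) * δ) * Real.exp (-δ * l1 (x - q)))) := by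
    refine abs_blockMeanAt_le_window hN x fun w hw => ?_
    have hwx := l1_sub_le_of_window hN x w hw
    refine (abs_treeGaugeAt_le_env hN hr hδ hC hA w).trans ?_
    refine mul_le_mul_of_nonneg_left (mul_le_mul_of_nonneg_left ?_ (by positivity)) (by positivity)
    rw [← Real.exp_add]
    refine Real.exp_le_exp.2 ?_
    have t : l1 (x - q) ≤ l1 (x - w) + l1 (w - q) := l1_sub_triangle x w q
    rw [l1_sub_symm x w] at t
    nlinarith
  have e4 : Real.exp (4 * (N : ℝ) * δ) ≤ Real.exp (8 * (N : ℝ) * δ) := Real.exp_le_exp.2 (by nlinarith)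
  have e8 : Real.exp (4 * (N : ℝ) * δ) * Real.exp (4 * (N : ℝ) * δ) = Real.exp (8 * (N : ℝ) * δ) := by rw [← Real.exp_add]; ring_nf
  simp only [bmGaugeAt, Pi.sub_apply]
  calc |treeGaugeAt (toSite r) A N x - blockMeanAt N (treeGaugeAt (toSite r) A N) x|
      ≤ |treeGaugeAt (toSite r) A N x| + |blockMeanAt N (treeGaugeAt (toSite r) A N) x| := abs_sub _ _
    _ ≤ 4 * (N : ℝ) * (C * Real.exp (8 * (N : ℝ) * δ) * Real.exp (-δ * l1 (x - q)))
        + 4 * (N : ℝ) * (C * Real.exp (8 * (N : ℝ) * δ) * Real.exp (-δ * l1 (x - q))) := by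
        refine add_le_add (h1.trans ?_) (h2.trans (le_of_eq ?_))
        · exact mul_le_mul_of_nonneg_left (mul_le_mul_of_nonneg_right (mul_le_mul_of_nonneg_left e4 hC) (Real.exp_pos _).le) (by positivity)
        · rw [← e8]; ring
    _ = _ := by ring

end Generic

/-! ## §2 The instance: the block gauge function of the undressed ℋ-column -/

section Column

variable (m : ℕ) {r : Fin (3 + 1) → ℕ} (hr : r ∈ box (3 + 1) (m + 1))

/-- [folklore] **THE UNDRESSED COLUMN's FINE ENVELOPE** as a form letter: `|colH K₀ n μ y κ w| ≤ n⁻⁵·M·P·e^{κ₁}·e^{−(κ₁∕(4n))|w − n•y|₁}`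
(`GhostWardWord.colH_K₀_eq_wH` + `RestJetEnvelopes.abs_wH_fine_le`). -/
theorem abs_colH_K₀_env (μ : Fin 4) (y : Site 4) (κ : Fin 4) (w : Site 4) :
    |colH (KInvStep (d := 3) (m + 1) 0) (m + 1) μ y κ w|
      ≤ ((((m + 1 : ℕ) : ℝ)) ^ (3 + 2))⁻¹ * (MG163 (3 + 1) * periodConst (kappa163 (3 + 1)) 3) * Real.exp (kappa163 (3 + 1) / (3 + 1))
          * Real.exp (-(kappa163 (3 + 1) / (3 + 1) / (4 * ((m + 1 : ℕ) : ℝ))) * l1 (w - ((m + 1 : ℕ) : ℤ) • y)) := by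
  rw [colH_K₀_eq_wH]
  exact abs_wH_fine_le m κ μ w y

include hr

/-- [folklore] **THE DECAYING ENVELOPE OF THE BLOCK GAUGE FUNCTION OF THE ROAD's CO-DRESSING**:
`|bmGaugeAt (toSite r) (colH K₀ n μ y) n x| ≤ 8·n·(n⁻⁵·M·P·e^{κ₁})·e^{2κ₁}·e^{−(κ₁∕(4n))|x − n•y|₁}` — power `n⁻⁴`, rate `κ₁∕(4n)`, `κ₁ = kappa163 4∕4`. -/
theorem abs_bmGauge_colH_K₀_le (μ : Fin 4) (y x : Site 4) :
    |bmGaugeAt (toSite r) (colH (KInvStep (d := 3) (m + 1) 0) (m + 1) μ y) (m + 1) x|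
      ≤ 8 * ((m + 1 : ℕ) : ℝ) * (((((m + 1 : ℕ) : ℝ)) ^ (3 + 2))⁻¹ * (MG163 (3 + 1) * periodConst (kappa163 (3 + 1)) 3) * Real.exp (kappa163 (3 + 1) / (3 + 1)))
          * Real.exp (8 * ((m + 1 : ℕ) : ℝ) * (kappa163 (3 + 1) / (3 + 1) / (4 * ((m + 1 : ℕ) : ℝ))))
          * Real.exp (-(kappa163 (3 + 1) / (3 + 1) / (4 * ((m + 1 : ℕ) : ℝ))) * l1 (x - ((m + 1 : ℕ) : ℤ) • y)) := by
  have hκ := kappa163_pos (3 + 1)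
  have hC : 0 ≤ ((((m + 1 : ℕ) : ℝ)) ^ (3 + 2))⁻¹ * (MG163 (3 + 1) * periodConst (kappa163 (3 + 1)) 3) * Real.exp (kappa163 (3 + 1) / (3 + 1)) := by
    have h := abs_colH_K₀_env m μ y 0 (((m + 1 : ℕ) : ℤ) • y)
    rw [sub_self, show l1 (0 : Site 4) = 0 by simp [l1], mul_zero, Real.exp_zero, mul_one] at h
    exact (abs_nonneg _).trans h
  exact abs_bmGaugeAt_le_env (Nat.le_add_left 1 m) hr (by positivity) hC (fun κ w => abs_colH_K₀_env m μ y κ w) x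

/-- [folklore] The same with the exponent simplified: `8n·(κ₁∕(4n)) = 2κ₁`, so the constant is `8·(M·P·e^{κ₁})·e^{2κ₁}·n⁻⁴` — **power `n⁻⁴`**, n-FREE otherwise. -/
theorem abs_bmGauge_colH_K₀_le' (μ : Fin 4) (y x : Site 4) :
    |bmGaugeAt (toSite r) (colH (KInvStep (d := 3) (m + 1) 0) (m + 1) μ y) (m + 1) x|
      ≤ 8 * ((MG163 (3 + 1) * periodConst (kappa163 (3 + 1)) 3) * Real.exp (kappa163 (3 + 1) / (3 + 1))) * Real.exp (2 * (kappa163 (3 + 1) / (3 + 1)))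
          * ((((m + 1 : ℕ) : ℝ)) ^ 4)⁻¹
          * Real.exp (-(kappa163 (3 + 1) / (3 + 1) / (4 * ((m + 1 : ℕ) : ℝ))) * l1 (x - ((m + 1 : ℕ) : ℤ) • y)) := by
  have hn : (0 : ℝ) < ((m + 1 : ℕ) : ℝ) := by exact_mod_cast Nat.succ_pos m
  refine (abs_bmGauge_colH_K₀_le m hr μ y x).trans (le_of_eq ?_)
  have e : 8 * ((m + 1 : ℕ) : ℝ) * (kappa163 (3 + 1) / (3 + 1) / (4 * ((m + 1 : ℕ) : ℝ))) = 2 * (kappa163 (3 + 1) / (3 + 1)) := by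
    field_simp; ring
  rw [e]
  field_simp

end Column

end Summit.QuantumFields.BalabanUV.Beta.D1BFx.BlockGaugeEnvelope

end
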